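import Mathlib
import Literature.Computability.AlgebraicComplexity.OrbitClosureEuclidean
import Literature.Computability.AlgebraicComplexity.BorderApolarityMembership
import Summits.ValiantsHypothesis.ValiantsHypothesis.Theorems.BorderApolarityToricFixedPointsCellRetractionAux2
import Summits.ValiantsHypothesis.ValiantsHypothesis.Theorems.BorderApolarityToricFixedPointsToricLimitIsInitialAux1
import Summits.ValiantsHypothesis.ValiantsHypothesis.Theorems.BorderApolarityFixedWitnessObstructionQPAnnSubmodule

/-!
# Border apolarity, support item `BorelFixedBorderApolarity` — the limit set is nonempty

Route `ValiantsHypothesis/BorderApolarity`, support item `stmt-ValiantsHypothesis-5781`, helper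
file: `bfba_nonempty` — if the padded permanent `pp` lies in the orbit closure `Δ(det_m)`, there is
a sequence `P_t ∈ GL · det_m` and a degree-wise (`k ≤ m`) Kuratowski limit `J = lim_t Ann(P_t)`
with `J_k ⌟ pp = 0`.  Steps:

* `bfba_exists_seq_of_mem_orbitClosure` — Zariski closure = Euclidean closure over `ℂ`
  (`orbitClosure_eq_euclidean_closure_complex_holds`) and first countability give
  `P_t ∈ GL · det_m` with `P_t → pp` coefficientwise;
* `bfba_extract` — sequential compactness of the Grassmannians, degree by degree: along a
  subsequence the annihilator planes `Ann_k(P_t)` converge for every `k ≤ m` (orthonormal frames in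
  the coordinate space of degree-`k` forms, `cr_exists_orthonormal_tendsto`; (Ls) by
  `cr_mem_span_of_tendsto`, (Li) from (Ls) by the dimension count `cr_coeff_li_of_ls`);
* `bfba_tendsto_apolarAction` — the apolarity pairing is jointly continuous on forms of fixed
  degrees, so the limit kills `pp` (Buczyńska–Buczyński 2021, Thm 1, necessity half).

Folklore.
-/

open MvPolynomial Filter
open scoped BigOperators Topology

namespace Summit.ValiantsHypothesis.ValiantsHypothesis.Theorems.BorderApolarityBorelFixedBorderApolarity

set_option linter.dupNamespace false

open Literature.Computability.AlgebraicComplexity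
open Summit.ValiantsHypothesis.ValiantsHypothesis.Theorems.BorderApolarityToricFixedPoints
open Summit.ValiantsHypothesis.ValiantsHypothesis.Theorems.BorderApolarityFixedWitnessObstructionQP
  (stub_annSubmodule stub_kuratowskiSubmodule mem_homogeneousSubmodule_of_tendsto)

/-! ## Continuity of the apolarity pairing on forms -/

section Pairing

variable {σ : Type} [Fintype σ] [DecidableEq σ]

/-- The pairing of two forms expanded in the monomial bases of their degrees. [folklore] -/
theorem bfba_apolarAction_eq_sum {k d : ℕ} {D f : MvPolynomial σ ℂ} (hD : D.IsHomogeneous k)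
    (hf : f.IsHomogeneous d) :
    apolarAction D f = ∑ e ∈ (Finset.univ : Finset σ).finsuppAntidiag k,
      ∑ e' ∈ (Finset.univ : Finset σ).finsuppAntidiag d,
        (coeff e D * coeff e' f) • apolarAction (monomial e (1 : ℂ)) (monomial e' (1 : ℂ)) := by
  conv_lhs => rw [tli_eq_sum_smul_monomial hD, tli_eq_sum_smul_monomial hf]
  rw [apolarAction_sum_left]
  refine Finset.sum_congr rfl fun e _ => ?_
  rw [apolarAction_smul_left, apolarAction_sum_right, Finset.smul_sum]
  refine Finset.sum_congr rfl fun e' _ => ?_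
  rw [apolarAction_smul_right, smul_smul]

/-- **Joint continuity of the pairing on forms of fixed degrees**: if `D_t → D` (degree `k`) and
`P_t → P` (degree `d`) coefficientwise then `D_t ⌟ P_t → D ⌟ P` coefficientwise. [folklore] -/
theorem bfba_tendsto_apolarAction {k d : ℕ} {Ds Ps : ℕ → MvPolynomial σ ℂ} {D P : MvPolynomial σ ℂ}
    (hDs : ∀ t, (Ds t).IsHomogeneous k) (hD : D.IsHomogeneous k)
    (hPs : ∀ t, (Ps t).IsHomogeneous d) (hP : P.IsHomogeneous d)
    (hlimD : Tendsto (fun t => coeffVec (Ds t)) atTop (𝓝 (coeffVec D)))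
    (hlimP : Tendsto (fun t => coeffVec (Ps t)) atTop (𝓝 (coeffVec P))) :
    Tendsto (fun t => coeffVec (apolarAction (Ds t) (Ps t))) atTop
      (𝓝 (coeffVec (apolarAction D P))) := by
  have key : ∀ (D' f : MvPolynomial σ ℂ), D'.IsHomogeneous k → f.IsHomogeneous d →
      coeffVec (apolarAction D' f) = ∑ e ∈ (Finset.univ : Finset σ).finsuppAntidiag k,
        ∑ e' ∈ (Finset.univ : Finset σ).finsuppAntidiag d,
          (coeff e D' * coeff e' f) • coeffVec (apolarAction (monomial e (1 : ℂ)) (monomial e' (1 : ℂ))) := by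
    intro D' f hD' hf
    rw [bfba_apolarAction_eq_sum hD' hf]
    funext u
    simp only [coeffVec_apply, coeff_sum, coeff_smul, Finset.sum_apply, Pi.smul_apply]
  have h1 : (fun t => coeffVec (apolarAction (Ds t) (Ps t))) = fun t =>
      ∑ e ∈ (Finset.univ : Finset σ).finsuppAntidiag k, ∑ e' ∈ (Finset.univ : Finset σ).finsuppAntidiag d,
        (coeff e (Ds t) * coeff e' (Ps t)) •
          coeffVec (apolarAction (monomial e (1 : ℂ)) (monomial e' (1 : ℂ))) := by
    funext t
    exact key _ _ (hDs t) (hPs t)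
  rw [h1, key D P hD hP]
  refine tendsto_finsetSum _ fun e _ => tendsto_finsetSum _ fun e' _ => ?_
  have hDe : Tendsto (fun t => coeff e (Ds t)) atTop (𝓝 (coeff e D)) := by
    have h := ((continuous_apply e).tendsto _).comp hlimD
    simpa only [Function.comp_def, coeffVec_apply] using h
  have hPe : Tendsto (fun t => coeff e' (Ps t)) atTop (𝓝 (coeff e' P)) := by
    have h := ((continuous_apply e').tendsto _).comp hlimP
    simpa only [Function.comp_def, coeffVec_apply] using h
  exact (hDe.mul hPe).smul_const _

end Pairing

/-! ## A convergent sequence in the orbit -/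

/-- **Zariski limits of the orbit are sequential Euclidean limits.**  If the padded permanent lies
in `Δ(det_m)` then some sequence `P_t ∈ GL · det_m` converges to it coefficientwise (Zariski =
Euclidean closure of an orbit over `ℂ`, `orbitClosure_eq_euclidean_closure_complex_holds`, plus
first countability of the finite-dimensional coefficient space). [folklore] -/
theorem bfba_exists_seq_of_mem_orbitClosure {n m : ℕ} [NeZero m] (hnm : n ≤ m)
    (hmem : paddedPerPoly ℂ n m ∈ orbitClosure (detPoly (Fin m) ℂ)) :
    ∃ P₀ : ℕ → MvPolynomial (Fin m × Fin m) ℂ,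
      (∀ t, P₀ t ∈ glOrbit (Fin m × Fin m) ℂ (detPoly (Fin m) ℂ)) ∧
      Tendsto (fun t => coeffVec (P₀ t)) atTop (𝓝 (coeffVec (paddedPerPoly ℂ n m))) := by
  classical
  have hdet : (detPoly (Fin m) ℂ).IsHomogeneous m := by
    have h := detPoly_isHomogeneous (n := Fin m) (k := ℂ)
    rwa [Fintype.card_fin] at h
  have hpp : (paddedPerPoly ℂ n m).IsHomogeneous m := paddedPerPoly_isHomogeneous hnm
  haveI hfin : Fintype {d : (Fin m × Fin m) →₀ ℕ // d.degree = m} :=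
    Fintype.subtype ((Finset.univ : Finset (Fin m × Fin m)).finsuppAntidiag m) fun d => by
      simp [Finset.mem_finsuppAntidiag, Finsupp.degree_eq_sum]
  set ρ : MvPolynomial (Fin m × Fin m) ℂ → ({d : (Fin m × Fin m) →₀ ℕ // d.degree = m} → ℂ) :=
    fun g d => coeffVec g d.1 with hρ
  have h := orbitClosure_eq_euclidean_closure_complex_holds (σ := Fin m × Fin m) hdet
  have h1 : ρ (paddedPerPoly ℂ n m) ∈ closure (ρ '' glOrbit (Fin m × Fin m) ℂ (detPoly (Fin m) ℂ)) := by
    rw [← h]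
    exact ⟨_, hmem, rfl⟩
  obtain ⟨x, hx, hxlim⟩ := mem_closure_iff_seq_limit.1 h1
  choose P₀ hP₀ hP₀x using hx
  refine ⟨P₀, hP₀, ?_⟩
  rw [tendsto_pi_nhds]
  intro d
  by_cases hd : d.degree = m
  · have h2 := ((continuous_apply (⟨d, hd⟩ : {d : (Fin m × Fin m) →₀ ℕ // d.degree = m})).tendsto _).comp hxlim
    have h3 : ∀ t, x t ⟨d, hd⟩ = coeffVec (P₀ t) d := fun t => by rw [← hP₀x t]
    simp only [Function.comp_def, h3] at h2
    exact h2
  · have hP₀hom : ∀ t, (P₀ t).IsHomogeneous m := fun t => by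
      have h4 := BorderApolarity.isHomogeneous_of_mem_glOrbit_detPoly (hP₀ t)
      rwa [Fintype.card_fin] at h4
    have h2 : ∀ t, coeffVec (P₀ t) d = 0 := fun t => (hP₀hom t).coeff_eq_zero hd
    have h3 : coeffVec (paddedPerPoly ℂ n m) d = 0 := hpp.coeff_eq_zero hd
    simp only [h2, h3]
    exact tendsto_const_nhds

/-! ## Sequential compactness, degree by degree -/

/-- **Extraction.**  For every sequence `Q_t ∈ GL · det_m` and every `K`, along some subsequence
the annihilator planes `Ann_k(Q_t)` Kuratowski-converge for all `k < K` (induction on `K`: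
orthonormal frames of `Ann_K` in the coordinate space of degree-`K` forms have a convergent
subsequence; their limit spans the limit plane; (Ls) by `cr_mem_span_of_tendsto`, (Li) by the
dimension count `cr_coeff_li_of_ls`; lower degrees persist along subsequences). [folklore] -/
theorem bfba_extract {m : ℕ} (Q : ℕ → MvPolynomial (Fin m × Fin m) ℂ)
    (hQ : ∀ t, Q t ∈ glOrbit (Fin m × Fin m) ℂ (detPoly (Fin m) ℂ)) :
    ∀ K : ℕ, ∃ φ : ℕ → ℕ, StrictMono φ ∧ ∃ J : ℕ → Set (MvPolynomial (Fin m × Fin m) ℂ),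
      IsBorderApolarLimit K (fun t => Q (φ t)) J := by
  classical
  haveI hfin : ∀ k, Module.Finite ℂ (homogeneousSubmodule (Fin m × Fin m) ℂ k) := fun k =>
    Module.Finite.iff_fg.2 (homogeneousSubmodule_fg _ ℂ k)
  -- it suffices to handle the degrees `< K`
  suffices H : ∀ K : ℕ, ∃ φ : ℕ → ℕ, StrictMono φ ∧ ∃ J : ℕ → Set (MvPolynomial (Fin m × Fin m) ℂ),
      ∀ k, k < K →
        (∀ D ∈ J k, ∃ Ds : ℕ → MvPolynomial (Fin m × Fin m) ℂ,
          (∀ t, Ds t ∈ annihilatorOfDegree (Q (φ t)) k) ∧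
            Tendsto (fun t => coeffVec (Ds t)) atTop (𝓝 (coeffVec D))) ∧
        (∀ (D : MvPolynomial (Fin m × Fin m) ℂ) (φ' : ℕ → ℕ) (Ds : ℕ → MvPolynomial (Fin m × Fin m) ℂ),
          StrictMono φ' → (∀ t, Ds t ∈ annihilatorOfDegree (Q (φ (φ' t))) k) →
            Tendsto (fun t => coeffVec (Ds t)) atTop (𝓝 (coeffVec D)) → D ∈ J k) by
    intro K
    obtain ⟨φ, hφ, J, hJ⟩ := H (K + 1)
    exact ⟨φ, hφ, J, fun k hk => (hJ k (Nat.lt_succ_of_le hk)).1,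
      fun k hk D φ' Ds hφ' hDs hlim => (hJ k (Nat.lt_succ_of_le hk)).2 D φ' Ds hφ' hDs hlim⟩
  intro K
  induction K with
  | zero => exact ⟨id, strictMono_id, fun _ => ∅, fun k hk => absurd hk (Nat.not_lt_zero k)⟩
  | succ K ih =>
    obtain ⟨φ, hφ, J, hJ⟩ := ih
    -- the degree-`K` annihilator planes along `φ`
    set cK : ℕ := Nat.choose (m * m + K - 1) K - (Nat.choose m K) ^ 2 with hcK
    have hB : ∀ t, ∃ B : Submodule ℂ (MvPolynomial (Fin m × Fin m) ℂ),
        (B : Set (MvPolynomial (Fin m × Fin m) ℂ)) = annihilatorOfDegree (Q (φ t)) K ∧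
        B ≤ homogeneousSubmodule (Fin m × Fin m) ℂ K ∧ Module.finrank ℂ B = cK :=
      fun t => stub_annSubmodule m K (Q (φ t)) (hQ (φ t))
    choose B hBeq hBle hBd using hB
    have hBmem : ∀ t D, D ∈ B t ↔ D ∈ annihilatorOfDegree (Q (φ t)) K := fun t D => by
      rw [← SetLike.mem_coe, hBeq]
    -- coordinates
    haveI : Fintype {e : (Fin m × Fin m) →₀ ℕ // e.degree = K} :=
      Fintype.subtype ((Finset.univ : Finset (Fin m × Fin m)).finsuppAntidiag K) fun e => by
        simp [Finset.mem_finsuppAntidiag, Finsupp.degree_eq_sum]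
    obtain ⟨π, hπ⟩ := cr_exists_coordMap (σ := Fin m × Fin m) K
    have hfinmap := cr_finrank_map_coord π hπ
    obtain ⟨ψ, hψ, b, c, hb, hbB, hc, hlim⟩ :=
      cr_exists_orthonormal_tendsto cK (fun t => (B t).map π) (fun t => (hfinmap _ (hBle t)).trans (hBd t))
    have hspan : ∀ t, Submodule.span ℂ (Set.range (b t)) = (B (ψ t)).map π := fun t =>
      cr_span_eq_of_orthonormal (hb t) ((hfinmap _ (hBle _)).trans (hBd _)) (hbB t)
    -- the limit plane in degree `K`
    set LK : Submodule ℂ (MvPolynomial (Fin m × Fin m) ℂ) :=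
      (Submodule.span ℂ (Set.range c)).comap π ⊓ homogeneousSubmodule (Fin m × Fin m) ℂ K with hLK
    have hLKle : LK ≤ homogeneousSubmodule (Fin m × Fin m) ℂ K := inf_le_right
    have hLKmap : LK.map π = Submodule.span ℂ (Set.range c) := by
      apply le_antisymm
      · rintro _ ⟨D, ⟨hD, -⟩, rfl⟩
        exact hD
      · intro x hx
        obtain ⟨D, hDhom, hDx⟩ := cr_exists_coord_eq π hπ x
        refine ⟨D, ⟨?_, hDhom⟩, hDx⟩
        show π D ∈ Submodule.span ℂ (Set.range c)
        rw [hDx]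
        exact hx
    have hLKd : Module.finrank ℂ LK = cK := by
      rw [← hfinmap LK hLKle, hLKmap, finrank_span_eq_card hc.linearIndependent, Fintype.card_fin]
    -- (Ls) in degree `K` along `φ ∘ ψ`
    have hLsK : ∀ (D : MvPolynomial (Fin m × Fin m) ℂ) (φ' : ℕ → ℕ)
        (Ds : ℕ → MvPolynomial (Fin m × Fin m) ℂ), StrictMono φ' →
        (∀ t, Ds t ∈ annihilatorOfDegree (Q (φ (ψ (φ' t)))) K) →
        Tendsto (fun t => coeffVec (Ds t)) atTop (𝓝 (coeffVec D)) → D ∈ LK := by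
      intro D φ' Ds hφ' hDs hDlim
      have hDshom : ∀ t, Ds t ∈ homogeneousSubmodule (Fin m × Fin m) ℂ K := fun t =>
        (mem_homogeneousSubmodule K _).2 (hDs t).1
      have hDhom : D ∈ homogeneousSubmodule (Fin m × Fin m) ℂ K :=
        mem_homogeneousSubmodule_of_tendsto K hDshom hDlim
      refine ⟨?_, hDhom⟩
      show π D ∈ Submodule.span ℂ (Set.range c)
      refine cr_mem_span_of_tendsto (fun t => hb (φ' t)) (fun i => (hlim i).comp hφ'.tendsto_atTop)
        (z := fun t => π (Ds t)) (fun t => ?_) ((cr_tendsto_coord_iff π hπ hDshom hDhom).1 hDlim)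
      rw [hspan]
      exact Submodule.mem_map_of_mem ((hBmem _ _).2 (hDs t))
    -- (Li) in degree `K` along `φ ∘ ψ`, by the dimension count
    have hLiK : ∀ D ∈ LK, ∃ Ds : ℕ → MvPolynomial (Fin m × Fin m) ℂ,
        (∀ t, Ds t ∈ annihilatorOfDegree (Q (φ (ψ t))) K) ∧
        Tendsto (fun t => coeffVec (Ds t)) atTop (𝓝 (coeffVec D)) := by
      intro D hD
      obtain ⟨Ds, hDs, hDlim⟩ := cr_coeff_li_of_ls cK (fun t => B (ψ t)) LK (fun t => hBle _) hLKle
        (fun t => hBd _) hLKd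
        (fun D' φ' Ds hφ' hDs hDlim => hLsK D' φ' Ds hφ' (fun t => (hBmem _ _).1 (hDs t)) hDlim) D hD
      exact ⟨Ds, fun t => (hBmem _ _).1 (hDs t), hDlim⟩
    refine ⟨fun t => φ (ψ t), hφ.comp hψ, fun k => if k = K then (LK : Set (MvPolynomial (Fin m × Fin m) ℂ)) else J k,
      fun k hk => ?_⟩
    by_cases hkK : k = K
    · subst hkK
      simp only [if_true]
      exact ⟨fun D hD => hLiK D hD, fun D φ' Ds hφ' hDs hDlim => hLsK D φ' Ds hφ' hDs hDlim⟩
    · have hk' : k < K := by omega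
      simp only [if_neg hkK]
      obtain ⟨hLi, hLs⟩ := hJ k hk'
      refine ⟨fun D hD => ?_, fun D φ' Ds hφ' hDs hDlim => ?_⟩
      · obtain ⟨Ds, hDs, hDlim⟩ := hLi D hD
        exact ⟨fun t => Ds (ψ t), fun t => hDs (ψ t), hDlim.comp hψ.tendsto_atTop⟩
      · exact hLs D (fun t => ψ (φ' t)) Ds (hψ.comp hφ') hDs hDlim

/-! ## Elements of `Y` are planes of forms -/

/-- Elements of `Y` are degree-wise subspaces of forms of the orbit dimension. [folklore] -/
theorem bfba_exists_submodule {m : ℕ} (P : ℕ → MvPolynomial (Fin m × Fin m) ℂ)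
    (hP : ∀ t, P t ∈ glOrbit (Fin m × Fin m) ℂ (detPoly (Fin m) ℂ))
    (J : ℕ → Set (MvPolynomial (Fin m × Fin m) ℂ)) (hJ : IsBorderApolarLimit m P J) :
    ∀ k ≤ m, ∃ Lk : Submodule ℂ (MvPolynomial (Fin m × Fin m) ℂ),
      (Lk : Set (MvPolynomial (Fin m × Fin m) ℂ)) = J k ∧
      Lk ≤ homogeneousSubmodule (Fin m × Fin m) ℂ k ∧
      Module.finrank ℂ Lk = Nat.choose (m * m + k - 1) k - (Nat.choose m k) ^ 2 := by
  intro k hk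
  have hA := fun t => stub_annSubmodule m k (P t) (hP t)
  choose A hAeq hAle hAd using hA
  exact stub_kuratowskiSubmodule k _ A (J k) hAle hAd
    (fun D hD => by
      obtain ⟨Ds, hDs, hlim⟩ := hJ.exists_tendsto hk hD
      exact ⟨Ds, fun t => by rw [← SetLike.mem_coe, hAeq]; exact hDs t, hlim⟩)
    (fun D φ Ds hφ hDs hlim => hJ.mem_of_tendsto hk hφ
      (fun t => by rw [← hAeq, SetLike.mem_coe]; exact hDs t) hlim)

/-! ## The limit set is nonempty -/

/-- **`Y ≠ ∅`.**  If `pp ∈ Δ(det_m)` (`n ≤ m`) then there are `P_t ∈ GL · det_m` and a degree-wise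
(`k ≤ m`) Kuratowski limit `J` of `Ann(P_t)` with `J_k ⌟ pp = 0`: take `P_t → pp`
(`bfba_exists_seq_of_mem_orbitClosure`), extract a convergent subsequence of annihilators
(`bfba_extract`), and pass to the limit in `D_t ⌟ P_t = 0` (`bfba_tendsto_apolarAction`).
Buczyńska–Buczyński 2021, Thm 1 (necessity), for the orbit closure of `det_m`. [folklore] -/
theorem bfba_nonempty {n m : ℕ} [NeZero m] (hnm : n ≤ m)
    (hmem : paddedPerPoly ℂ n m ∈ orbitClosure (detPoly (Fin m) ℂ)) :
    ∃ (P : ℕ → MvPolynomial (Fin m × Fin m) ℂ) (J : ℕ → Set (MvPolynomial (Fin m × Fin m) ℂ)),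
      (∀ t, P t ∈ glOrbit (Fin m × Fin m) ℂ (detPoly (Fin m) ℂ)) ∧ IsBorderApolarLimit m P J ∧
      (∀ k ≤ m, ∀ D ∈ J k, apolarAction D (paddedPerPoly ℂ n m) = 0) := by
  obtain ⟨P₀, hP₀, hlim⟩ := bfba_exists_seq_of_mem_orbitClosure hnm hmem
  obtain ⟨φ, hφ, J, hJ⟩ := bfba_extract P₀ hP₀ m
  refine ⟨fun t => P₀ (φ t), J, fun t => hP₀ (φ t), hJ, fun k hk D hD => ?_⟩
  obtain ⟨Ds, hDs, hDlim⟩ := hJ.exists_tendsto hk hD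
  have hpp : (paddedPerPoly ℂ n m).IsHomogeneous m := paddedPerPoly_isHomogeneous hnm
  have hPhom : ∀ t, (P₀ (φ t)).IsHomogeneous m := fun t => by
    have h4 := BorderApolarity.isHomogeneous_of_mem_glOrbit_detPoly (hP₀ (φ t))
    rwa [Fintype.card_fin] at h4
  have h := bfba_tendsto_apolarAction (fun t => (hDs t).1) (hJ.isHomogeneous_of_mem hk hD) hPhom hpp
    hDlim (hlim.comp hφ.tendsto_atTop)
  have h0 : (fun t => coeffVec (apolarAction (Ds t) (P₀ (φ t)))) = fun _ => coeffVec 0 := by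
    funext t
    rw [(hDs t).2]
  rw [h0] at h
  exact coeffVec_injective (tendsto_nhds_unique tendsto_const_nhds h).symm

end Summit.ValiantsHypothesis.ValiantsHypothesis.Theorems.BorderApolarityBorelFixedBorderApolarity
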